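import Literature.NumberTheory.Automorphic.QuaternionRamificationParityHolds
import Literature.NumberTheory.QuadraticForms.NormIndexFromReciprocityProofs
import HarnessLib

/-!
# O'Meara 71:19 / 71:19a — elements with prescribed Hilbert symbols — DISCHARGED

Topic `NumberTheory/QuadraticForms`, namespace `Literature.NumberTheory.QuadraticForms`.  Theorems only.
The named fact `exists_hilbertSymbol_eq_neg_one_iff K` of `HilbertSymbolPrescribed.lean` — O'Meara,
*Introduction to Quadratic Forms* (1963), §71 Thm. 71:19 with Cor. 71:19a: for a number field `K`, a
finite set `S` of finite places and a finite set `T` of real places with `|S| + |T|` even, and `a ∈ K` a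
non-square at every place of `S ∪ T`, there is `θ ∈ Kˣ` whose Hilbert symbol `(θ, a)_𝔭` is `-1` exactly
at the places of `S ∪ T` — is proved for EVERY number field `K` (`exists_hilbertSymbol_eq_neg_one_iff_holds`)
by feeding Hilbert's reciprocity law 71:18, a theorem of the tree (`hilbertReciprocity_holds`,
`Automorphic/QuaternionRamificationParityHolds.lean`), to the reduction
`exists_hilbertSymbol_eq_neg_one_iff_of_hilbertReciprocity` (`NormIndexFromReciprocityProofs.lean`:
O'Meara's own proof of 71:19 from 65:21 — the norm index `(J_K : P_K N_{E/K} J_E) = 2`,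
`normIdeles_index_eq_two_of_hilbertReciprocity` — and 63:13, a local non-norm,
`adicCompletion_exists_hilbertSymbol_eq_neg_one_holds`).  Equivalently (Vignéras III §3 Thm. 3.7):
`θ` is a local norm from `K(√a)` exactly outside `S ∪ T`.

Consumers that took `(h : exists_hilbertSymbol_eq_neg_one_iff K)` as a hypothesis:
`exists_isQuaternionAlgebra_of_even_of_exists_hilbertSymbol_eq_neg_one_iff`
(`Automorphic/QuaternionAlgebraExistence.lean`), `QuaternionAlgebraSplitting.lean`,
`QuaternionAlgebraHasse.lean`.

## References
* O. T. O'Meara, *Introduction to Quadratic Forms*, Grundlehren 117, Springer 1963, §71 Thm. 71:19 and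
  Cor. 71:19a (p. 203), Thm. 71:18, Prop. 65:21, 63:13. [Omeara1963]
-/

namespace Literature.NumberTheory.QuadraticForms

/-- **O'Meara 71:19 with 71:19a HOLDS for every number field `K`** (elements with prescribed local
Hilbert symbols: given `a` a non-square at the places of `S ∪ T`, `S` finite places, `T` real places,
`|S| + |T|` even, some `θ ≠ 0` has `(θ, a)_v = -1` exactly for `v ∈ S` among the finite places and
`(θ, a)_w = -1` exactly for `w ∈ T` among the infinite ones) — from Hilbert reciprocity 71:18
(`hilbertReciprocity_holds`) by O'Meara's proof (`exists_hilbertSymbol_eq_neg_one_iff_of_hilbertReciprocity`).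
[cite: Omeara1963, §71 Thm. 71:19 and Cor. 71:19a] -/
theorem exists_hilbertSymbol_eq_neg_one_iff_holds (K : Type) [Field K] [NumberField K] :
    exists_hilbertSymbol_eq_neg_one_iff K :=
  exists_hilbertSymbol_eq_neg_one_iff_of_hilbertReciprocity K (hilbertReciprocity_holds K)

end Literature.NumberTheory.QuadraticForms
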